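import Summits.AtomisticToContinuum.Crystallization.Theses.BrittleRungDescent
import Literature.Geometry.DiscreteGeometry.TameContactGraphs

/-!
# `SoftLocalHales` from Hales's classification of kissing configurations (compactness)

Helper file for item stmt-AtomisticToContinuum-10944 (`SoftLocalHales`, support of route
`AtomisticToContinuum/Crystallization/BrittleRungDescent`).  We prove the route's soft local-Hales
statement from the named Literature fact `Hales2012_contactGraphFccOrHcp` (Hales 2012, Theorem 3
with Lemma 9: the contact graph of every `V ∈ 𝒱` is the FCC or the HCP contact graph), hence from
the weaker-looking computer-assisted fact `Hales2012_contactGraphTame` (Theorem 3 with Lemma 8) via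
the PROVED `contactGraphFccOrHcp_of_contactGraphTame` (Lemma 9, `TameContactGraphs.lean`).

The argument is the compactness one recorded in the item text: if the statement failed for every
`η₀ > 0`, there would be soft shells `q⁽ⁿ⁾ : Fin 12 → ℝ³` (the twelve neighbours of `u`, recentred
at `u`) with tolerances `ηₙ → 0` and no admissible bijection onto either pattern; a subsequence
converges to `a : Fin 12 → ℝ³` with `‖aᵢ‖ = 1` and pairwise distances `= 1` or `≥ 63/50` (the gap
dichotomy passes to the limit), so `2a` is a kissing configuration of Hales's class `𝒱`
(`IsKissingConfig`); its contact graph is FCC or HCP by the fact, and for `n` large the soft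
contact relation `dist ≤ 1 + ηₙ` on `q⁽ⁿ⁾` coincides with the contact relation `dist = 1` on `a`
(again by the dichotomy), so the bijection for `a` serves `q⁽ⁿ⁾` — a contradiction.  Only the
hypotheses AT `u` and the separation/dichotomy at its neighbours are used (no `L12`, no
kissing-number theorem).

Main results: `softLocalHales_of_contactGraphFccOrHcp`, `softLocalHales_of_contactGraphTame`.
-/

noncomputable section

namespace Summit.AtomisticToContinuum.Crystallization.Theorems

open Filter Topology
open Literature.Geometry.DiscreteGeometry
open Summit.AtomisticToContinuum.Crystallization.Theses.BrittleRungDescent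

/-! ### Step 1. The exact classification, re-indexed by `Fin 12` at unit scale -/

/-- **Hales's classification at unit scale, indexed form.**  Under `Hales2012_contactGraphFccOrHcp`:
twelve unit vectors with pairwise distances `≥ 1`, each `= 1` or `≥ 63/50`, admit a bijection with
the FCC or the HCP kissing pattern matching "distance `1`" with "distance `1`".  (The doubled
configuration is a kissing configuration of Hales's class `𝒱`; transport the graph isomorphism.)
[cite: Hales2012, Theorem 3 and Lemma 9] -/
theorem exists_equiv_pattern_of_contactGraphFccOrHcp (hH : Hales2012_contactGraphFccOrHcp)
    (a : Fin 12 → EuclideanSpace ℝ (Fin 3)) (hnorm : ∀ i, ‖a i‖ = 1)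
    (hsep : ∀ i j, i ≠ j → 1 ≤ dist (a i) (a j))
    (hgap : ∀ i j, i ≠ j → dist (a i) (a j) = 1 ∨ 63 / 50 ≤ dist (a i) (a j)) :
    (∃ g : Fin 12 ≃ {p : EuclideanSpace ℝ (Fin 3) // p ∈ fccKissingPattern},
        ∀ i j, i ≠ j → (dist (a i) (a j) = 1 ↔ dist (g i).1 (g j).1 = 1)) ∨
      (∃ g : Fin 12 ≃ {p : EuclideanSpace ℝ (Fin 3) // p ∈ hcpKissingPattern},
        ∀ i j, i ≠ j → (dist (a i) (a j) = 1 ↔ dist (g i).1 (g j).1 = 1)) := by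
  classical
  -- the doubled configuration
  set f : Fin 12 → EuclideanSpace ℝ (Fin 3) := fun i => (2 : ℝ) • a i with hf
  have hdist2 : ∀ x y : EuclideanSpace ℝ (Fin 3), dist ((2 : ℝ) • x) ((2 : ℝ) • y) = 2 * dist x y := by
    intro x y
    rw [dist_smul₀, Real.norm_of_nonneg zero_le_two]
  have hfdist : ∀ i j, dist (f i) (f j) = 2 * dist (a i) (a j) := fun i j => hdist2 _ _
  have hainj : Function.Injective a := by
    intro i j hij
    by_contra hne
    have := hsep i j hne
    rw [hij, dist_self] at this
    linarith
  have hfinj : Function.Injective f := by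
    intro i j hij
    apply hainj
    have := congrArg (fun x => (2 : ℝ)⁻¹ • x) hij
    simpa [hf, smul_smul] using this
  set T : Set (EuclideanSpace ℝ (Fin 3)) := Set.range f with hT
  have hTK : IsKissingConfig T := by
    refine ⟨?_, ?_, ?_⟩
    · rw [hT, Set.ncard_range_of_injective hfinj, Nat.card_eq_fintype_card, Fintype.card_fin]
    · rintro _ ⟨i, rfl⟩
      rw [hf]
      simp only [norm_smul, Real.norm_of_nonneg zero_le_two, hnorm, mul_one]
    · rintro _ ⟨i, rfl⟩ _ ⟨j, rfl⟩
      by_cases hij : i = j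
      · exact Or.inl (by rw [hij])
      · right
        rw [hfdist, hales_h0_eq]
        rcases hgap i j hij with h | h
        · exact Or.inl (by rw [h]; norm_num)
        · exact Or.inr (by linarith)
  -- `Fin 12 ≃ T`
  set ι : Fin 12 ≃ T := Equiv.ofInjective f hfinj with hι
  have hι1 : ∀ i, (ι i).1 = f i := fun i => rfl
  -- adjacency in `contactGraph T` versus distance `1` in `a`
  have hadjT : ∀ i j, ((contactGraph T).Adj (ι i) (ι j) ↔ dist (a i) (a j) = 1) := by
    intro i j
    rw [contactGraph_adj, hι1, hι1, hfdist]
    constructor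
    · intro h; linarith
    · intro h; rw [h]; norm_num
  -- the pattern side: `↥(2 • P) ≃ {p // p ∈ P}` with control of distances
  have pat : ∀ P : Finset (EuclideanSpace ℝ (Fin 3)),
      ∃ κ : ((fun p => (2 : ℝ) • p) '' (P : Set (EuclideanSpace ℝ (Fin 3)))) ≃
          {p : EuclideanSpace ℝ (Fin 3) // p ∈ P},
        ∀ x : ((fun p => (2 : ℝ) • p) '' (P : Set (EuclideanSpace ℝ (Fin 3)))),
          x.1 = (2 : ℝ) • (κ x).1 := by
    intro P
    have hinj : Function.Injective (fun p : EuclideanSpace ℝ (Fin 3) => (2 : ℝ) • p) := by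
      intro x y hxy
      have := congrArg (fun z => (2 : ℝ)⁻¹ • z) hxy
      simpa [smul_smul] using this
    let κ₀ : ((P : Set (EuclideanSpace ℝ (Fin 3)))) ≃
        ((fun p => (2 : ℝ) • p) '' (P : Set (EuclideanSpace ℝ (Fin 3)))) :=
      Equiv.Set.image _ _ hinj
    let κ₁ : ((P : Set (EuclideanSpace ℝ (Fin 3)))) ≃ {p : EuclideanSpace ℝ (Fin 3) // p ∈ P} :=
      Equiv.subtypeEquivRight (fun _ => Finset.mem_coe)
    refine ⟨κ₀.symm.trans κ₁, fun x => ?_⟩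
    have hx : κ₀ (κ₀.symm x) = x := κ₀.apply_symm_apply x
    have h1 : ((κ₀ (κ₀.symm x) : _) : EuclideanSpace ℝ (Fin 3)) = (2 : ℝ) • (κ₀.symm x).1 :=
      congrArg Subtype.val (Equiv.Set.image_apply _ _ hinj _)
    rw [hx] at h1
    rw [h1]
    rfl
  -- transport along the graph isomorphism
  have transport : ∀ P : Finset (EuclideanSpace ℝ (Fin 3)),
      Nonempty (contactGraph T ≃g
        contactGraph ((fun p => (2 : ℝ) • p) '' (P : Set (EuclideanSpace ℝ (Fin 3))))) →
      ∃ g : Fin 12 ≃ {p : EuclideanSpace ℝ (Fin 3) // p ∈ P},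
        ∀ i j, i ≠ j → (dist (a i) (a j) = 1 ↔ dist (g i).1 (g j).1 = 1) := by
    rintro P ⟨φ⟩
    obtain ⟨κ, hκ⟩ := pat P
    refine ⟨(ι.trans φ.toEquiv).trans κ, fun i j _ => ?_⟩
    rw [← hadjT, ← φ.map_adj_iff, contactGraph_adj]
    simp only [Equiv.trans_apply, RelIso.coe_fn_toEquiv]
    rw [hκ (φ (ι i)), hκ (φ (ι j)), hdist2]
    constructor
    · intro h; linarith
    · intro h; rw [h]; norm_num
  rcases hH T hTK with h | h
  · exact Or.inl (transport _ h)
  · exact Or.inr (transport _ h)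

/-! ### Step 2. Passing to the limit along a sequence of soft shells -/

/-- **The gap dichotomy passes to the limit.**  If soft shells `qₙ : Fin 12 → ℝ³` with tolerances
`ηₙ → 0` (radii in `[1 − ηₙ, 1 + ηₙ]`, pairwise distances `≥ 1 − ηₙ`, each `≤ 1 + ηₙ` or `≥ 63/50`)
converge to `a`, then `a` consists of unit vectors with pairwise distances `≥ 1`, each `= 1` or
`≥ 63/50`. [folklore] -/
theorem exact_of_soft_limit (η : ℕ → ℝ) (q : ℕ → Fin 12 → EuclideanSpace ℝ (Fin 3))
    (a : Fin 12 → EuclideanSpace ℝ (Fin 3)) (hη : Tendsto η atTop (𝓝 0))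
    (hnorm : ∀ n i, 1 - η n ≤ ‖q n i‖ ∧ ‖q n i‖ ≤ 1 + η n)
    (hsep : ∀ n i j, i ≠ j → 1 - η n ≤ dist (q n i) (q n j))
    (hgap : ∀ n i j, i ≠ j → dist (q n i) (q n j) ≤ 1 + η n ∨ 63 / 50 ≤ dist (q n i) (q n j))
    (hq : Tendsto q atTop (𝓝 a)) :
    (∀ i, ‖a i‖ = 1) ∧ (∀ i j, i ≠ j → 1 ≤ dist (a i) (a j)) ∧
      (∀ i j, i ≠ j → dist (a i) (a j) = 1 ∨ 63 / 50 ≤ dist (a i) (a j)) := by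
  have hqi : ∀ i, Tendsto (fun n => q n i) atTop (𝓝 (a i)) := fun i => tendsto_pi_nhds.1 hq i
  have hnorm_lim : ∀ i, Tendsto (fun n => ‖q n i‖) atTop (𝓝 ‖a i‖) := fun i => (hqi i).norm
  have hdist_lim : ∀ i j, Tendsto (fun n => dist (q n i) (q n j)) atTop (𝓝 (dist (a i) (a j))) :=
    fun i j => (hqi i).dist (hqi j)
  have h1m : Tendsto (fun n => 1 - η n) atTop (𝓝 1) := by
    simpa using (tendsto_const_nhds (x := (1 : ℝ))).sub hη
  have h1p : Tendsto (fun n => 1 + η n) atTop (𝓝 1) := by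
    simpa using (tendsto_const_nhds (x := (1 : ℝ))).add hη
  have hge : ∀ i j, i ≠ j → 1 ≤ dist (a i) (a j) := fun i j hij =>
    le_of_tendsto_of_tendsto' h1m (hdist_lim i j) (fun n => hsep n i j hij)
  refine ⟨fun i => ?_, hge, fun i j hij => ?_⟩
  · have hsq : Tendsto (fun n => ‖q n i‖) atTop (𝓝 1) :=
      tendsto_of_tendsto_of_tendsto_of_le_of_le h1m h1p (fun n => (hnorm n i).1)
        (fun n => (hnorm n i).2)
    exact tendsto_nhds_unique (hnorm_lim i) hsq
  · by_contra hcon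
    push Not at hcon
    obtain ⟨hne1, hlt⟩ := hcon
    have hgt : 1 < dist (a i) (a j) := lt_of_le_of_ne (hge i j hij) (Ne.symm hne1)
    set d := dist (a i) (a j) with hd
    set ε := min ((d - 1) / 2) ((63 / 50 - d) / 2) with hε
    have hεpos : 0 < ε := lt_min (by linarith) (by linarith)
    have ev1 : ∀ᶠ n in atTop, dist (dist (q n i) (q n j)) d < ε :=
      (Metric.tendsto_nhds.1 (hdist_lim i j)) ε hεpos
    have ev2 : ∀ᶠ n in atTop, dist (η n) 0 < ε := (Metric.tendsto_nhds.1 hη) ε hεpos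
    obtain ⟨n, hn1, hn2⟩ := (ev1.and ev2).exists
    rw [Real.dist_eq] at hn1 hn2
    rw [sub_zero] at hn2
    have hε1 : ε ≤ (d - 1) / 2 := min_le_left _ _
    have hε2 : ε ≤ (63 / 50 - d) / 2 := min_le_right _ _
    have habs := abs_lt.1 hn1
    have hηabs := abs_lt.1 hn2
    rcases hgap n i j hij with h | h
    · linarith [habs.1]
    · linarith [habs.2]

/-- **Eventually the soft shell is `1/100`-close to its limit and the tolerance is `< 1/100`.**
[folklore] -/
theorem exists_index_close (η : ℕ → ℝ) (q : ℕ → Fin 12 → EuclideanSpace ℝ (Fin 3))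
    (a : Fin 12 → EuclideanSpace ℝ (Fin 3)) (hη : Tendsto η atTop (𝓝 0))
    (hq : Tendsto q atTop (𝓝 a)) :
    ∃ n, η n < 1 / 100 ∧ ∀ i j, |dist (q n i) (q n j) - dist (a i) (a j)| < 1 / 100 := by
  have hqi : ∀ i, Tendsto (fun n => q n i) atTop (𝓝 (a i)) := fun i => tendsto_pi_nhds.1 hq i
  have ev1 : ∀ᶠ n in atTop, η n < 1 / 100 := by
    have := (Metric.tendsto_nhds.1 hη) (1 / 100) (by norm_num)
    refine this.mono fun n hn => ?_
    rw [Real.dist_eq, sub_zero] at hn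
    exact (abs_lt.1 hn).2
  have ev2 : ∀ᶠ n in atTop, ∀ p : Fin 12 × Fin 12,
      |dist (q n p.1) (q n p.2) - dist (a p.1) (a p.2)| < 1 / 100 := by
    rw [Filter.eventually_all]
    intro p
    have := (Metric.tendsto_nhds.1 ((hqi p.1).dist (hqi p.2))) (1 / 100) (by norm_num)
    refine this.mono fun n hn => ?_
    rwa [Real.dist_eq] at hn
  obtain ⟨n, hn1, hn2⟩ := (ev1.and ev2).exists
  exact ⟨n, hn1, fun i j => hn2 (i, j)⟩

/-- **Transfer of the contact relation.**  For a soft shell `q` with tolerance `η < 1/100` and gap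
`63/50` that is `1/100`-close to an exact shell `a` (pairwise distances `= 1` or `≥ 63/50`), soft
contact `dist ≤ 1 + η` in `q` is exactly contact `dist = 1` in `a`. [folklore] -/
theorem soft_adj_iff_of_close {η : ℝ} (hη : η < 1 / 100)
    (q a : Fin 12 → EuclideanSpace ℝ (Fin 3))
    (hgapq : ∀ i j, i ≠ j → dist (q i) (q j) ≤ 1 + η ∨ 63 / 50 ≤ dist (q i) (q j))
    (hgapa : ∀ i j, i ≠ j → dist (a i) (a j) = 1 ∨ 63 / 50 ≤ dist (a i) (a j))
    (hclose : ∀ i j, |dist (q i) (q j) - dist (a i) (a j)| < 1 / 100) :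
    ∀ i j, i ≠ j → (dist (q i) (q j) ≤ 1 + η ↔ dist (a i) (a j) = 1) := by
  intro i j hij
  have hc := abs_lt.1 (hclose i j)
  constructor
  · intro h
    rcases hgapa i j hij with h' | h'
    · exact h'
    · exfalso
      linarith [hc.1]
  · intro h
    rcases hgapq i j hij with h' | h'
    · exact h'
    · exfalso
      rw [h] at hc
      linarith [hc.2]

/-- **Compactness.**  If every exact shell (twelve unit vectors, pairwise distances `≥ 1`, each
`= 1` or `≥ 63/50`) admits a contact-matching bijection onto the FCC or the HCP pattern, then for
some `η₀ > 0` every soft shell with tolerance `η ≤ η₀` (radii in `[1 − η, 1 + η]`, pairwise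
distances `≥ 1 − η`, each `≤ 1 + η` or `≥ 63/50`) admits a bijection matching soft contact
`dist ≤ 1 + η` with pattern contact `dist = 1` (Bolzano–Weierstrass on `(ℝ³)¹²` and the two lemmas
above). [folklore] -/
theorem soft_classification_of_exact
    (hex : ∀ a : Fin 12 → EuclideanSpace ℝ (Fin 3), (∀ i, ‖a i‖ = 1) →
      (∀ i j, i ≠ j → 1 ≤ dist (a i) (a j)) →
      (∀ i j, i ≠ j → dist (a i) (a j) = 1 ∨ 63 / 50 ≤ dist (a i) (a j)) →
      (∃ g : Fin 12 ≃ {p : EuclideanSpace ℝ (Fin 3) // p ∈ fccKissingPattern},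
          ∀ i j, i ≠ j → (dist (a i) (a j) = 1 ↔ dist (g i).1 (g j).1 = 1)) ∨
        (∃ g : Fin 12 ≃ {p : EuclideanSpace ℝ (Fin 3) // p ∈ hcpKissingPattern},
          ∀ i j, i ≠ j → (dist (a i) (a j) = 1 ↔ dist (g i).1 (g j).1 = 1))) :
    ∃ η₀ : ℝ, 0 < η₀ ∧ ∀ η : ℝ, 0 < η → η ≤ η₀ → ∀ q : Fin 12 → EuclideanSpace ℝ (Fin 3),
      (∀ i, 1 - η ≤ ‖q i‖ ∧ ‖q i‖ ≤ 1 + η) →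
      (∀ i j, i ≠ j → 1 - η ≤ dist (q i) (q j) ∧
        (dist (q i) (q j) ≤ 1 + η ∨ 63 / 50 ≤ dist (q i) (q j))) →
      (∃ g : Fin 12 ≃ {p : EuclideanSpace ℝ (Fin 3) // p ∈ fccKissingPattern},
          ∀ i j, i ≠ j → (dist (q i) (q j) ≤ 1 + η ↔ dist (g i).1 (g j).1 = 1)) ∨
        (∃ g : Fin 12 ≃ {p : EuclideanSpace ℝ (Fin 3) // p ∈ hcpKissingPattern},
          ∀ i j, i ≠ j → (dist (q i) (q j) ≤ 1 + η ↔ dist (g i).1 (g j).1 = 1)) := by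
  by_contra H
  have H' : ∀ n : ℕ, ∃ η : ℝ, ∃ q : Fin 12 → EuclideanSpace ℝ (Fin 3),
      0 < η ∧ η ≤ 1 / ((n : ℝ) + 1) ∧
      (∀ i, 1 - η ≤ ‖q i‖ ∧ ‖q i‖ ≤ 1 + η) ∧
      (∀ i j, i ≠ j → 1 - η ≤ dist (q i) (q j) ∧
        (dist (q i) (q j) ≤ 1 + η ∨ 63 / 50 ≤ dist (q i) (q j))) ∧
      ¬ ((∃ g : Fin 12 ≃ {p : EuclideanSpace ℝ (Fin 3) // p ∈ fccKissingPattern},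
          ∀ i j, i ≠ j → (dist (q i) (q j) ≤ 1 + η ↔ dist (g i).1 (g j).1 = 1)) ∨
        (∃ g : Fin 12 ≃ {p : EuclideanSpace ℝ (Fin 3) // p ∈ hcpKissingPattern},
          ∀ i j, i ≠ j → (dist (q i) (q j) ≤ 1 + η ↔ dist (g i).1 (g j).1 = 1))) := by
    intro n
    by_contra H''
    apply H
    refine ⟨1 / ((n : ℝ) + 1), by positivity, fun η hη hηle q h1 h2 => ?_⟩
    by_contra hg
    exact H'' ⟨η, q, hη, hηle, h1, h2, hg⟩
  choose η q hη0 hηle hn hp hbad using H'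
  -- `ηₙ → 0`
  have hηlim : Tendsto η atTop (𝓝 0) :=
    tendsto_of_tendsto_of_tendsto_of_le_of_le tendsto_const_nhds
      tendsto_one_div_add_atTop_nhds_zero_nat (fun n => (hη0 n).le) hηle
  -- the shells are bounded in `(ℝ³)¹²`
  have hbd : ∀ n, q n ∈ Metric.closedBall (0 : Fin 12 → EuclideanSpace ℝ (Fin 3)) 2 := by
    intro n
    rw [Metric.mem_closedBall, dist_zero_right]
    refine (pi_norm_le_iff_of_nonneg (by norm_num)).2 fun i => ?_
    have h1 := (hn n i).2
    have h2 := hηle n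
    have h3 : (1 : ℝ) / ((n : ℝ) + 1) ≤ 1 := by
      rw [div_le_one (by positivity)]
      have : (0 : ℝ) ≤ n := Nat.cast_nonneg n
      linarith
    linarith
  obtain ⟨a, -, φ, hφ, hlim⟩ := tendsto_subseq_of_bounded Metric.isBounded_closedBall hbd
  have hηlim' : Tendsto (η ∘ φ) atTop (𝓝 0) := hηlim.comp hφ.tendsto_atTop
  obtain ⟨ha1, ha2, ha3⟩ := exact_of_soft_limit (η ∘ φ) (q ∘ φ) a hηlim'
    (fun n i => hn (φ n) i) (fun n i j h => (hp (φ n) i j h).1)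
    (fun n i j h => (hp (φ n) i j h).2) hlim
  obtain ⟨n, hn1, hn2⟩ := exists_index_close (η ∘ φ) (q ∘ φ) a hηlim' hlim
  have hiff := soft_adj_iff_of_close hn1 (q (φ n)) a (fun i j h => (hp (φ n) i j h).2) ha3 hn2
  apply hbad (φ n)
  rcases hex a ha1 ha2 ha3 with ⟨g, hg⟩ | ⟨g, hg⟩
  · exact Or.inl ⟨g, fun i j hij => (hiff i j hij).trans (hg i j hij)⟩
  · exact Or.inr ⟨g, fun i j hij => (hiff i j hij).trans (hg i j hij)⟩

/-! ### Step 3. Bookkeeping: from indexed soft shells to the route statement -/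

/-- **`SoftLocalHales` from the soft classification of indexed shells**: enumerate the twelve
soft neighbours of `u` (a set of `ncard = 12`) by `Fin 12`, recentre at `u`, and transport the
bijection.  The separation and dichotomy hypotheses of the route statement at `u` and at the
neighbours give exactly the soft-shell conditions. [folklore] -/
theorem softLocalHales_of_soft_classification
    (hC : ∃ η₀ : ℝ, 0 < η₀ ∧ ∀ η : ℝ, 0 < η → η ≤ η₀ → ∀ q : Fin 12 → EuclideanSpace ℝ (Fin 3),
      (∀ i, 1 - η ≤ ‖q i‖ ∧ ‖q i‖ ≤ 1 + η) →
      (∀ i j, i ≠ j → 1 - η ≤ dist (q i) (q j) ∧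
        (dist (q i) (q j) ≤ 1 + η ∨ 63 / 50 ≤ dist (q i) (q j))) →
      (∃ g : Fin 12 ≃ {p : EuclideanSpace ℝ (Fin 3) // p ∈ fccKissingPattern},
          ∀ i j, i ≠ j → (dist (q i) (q j) ≤ 1 + η ↔ dist (g i).1 (g j).1 = 1)) ∨
        (∃ g : Fin 12 ≃ {p : EuclideanSpace ℝ (Fin 3) // p ∈ hcpKissingPattern},
          ∀ i j, i ≠ j → (dist (q i) (q j) ≤ 1 + η ↔ dist (g i).1 (g j).1 = 1))) :
    SoftLocalHales := by
  classical
  obtain ⟨η₀, hη₀, hC⟩ := hC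
  refine ⟨η₀, hη₀, fun η hη hηle S u hu hyp => ?_⟩
  obtain ⟨h1u, h2u⟩ := hyp u hu (by rw [dist_self]; linarith)
  -- the shell subtype and its enumeration
  have hfin : {w ∈ S | w ≠ u ∧ dist u w ≤ 1 + η}.Finite :=
    Set.finite_of_ncard_ne_zero (by rw [h2u]; norm_num)
  haveI : Finite {w : EuclideanSpace ℝ (Fin 3) // w ∈ S ∧ w ≠ u ∧ dist u w ≤ 1 + η} :=
    hfin.to_subtype
  have hcard : Nat.card {w : EuclideanSpace ℝ (Fin 3) // w ∈ S ∧ w ≠ u ∧ dist u w ≤ 1 + η} = 12 := by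
    rw [← h2u, ← Nat.card_coe_set_eq]
    rfl
  set σ : {w : EuclideanSpace ℝ (Fin 3) // w ∈ S ∧ w ≠ u ∧ dist u w ≤ 1 + η} ≃ Fin 12 :=
    (Finite.equivFin _).trans (finCongr hcard) with hσ
  set q : Fin 12 → EuclideanSpace ℝ (Fin 3) := fun i => (σ.symm i).1 - u with hq
  have hmem : ∀ i, (σ.symm i).1 ∈ S ∧ (σ.symm i).1 ≠ u ∧ dist u (σ.symm i).1 ≤ 1 + η :=
    fun i => (σ.symm i).2
  have hqnorm : ∀ i, ‖q i‖ = dist u (σ.symm i).1 := by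
    intro i
    rw [hq, dist_comm, dist_eq_norm]
  have hqdist : ∀ i j, dist (q i) (q j) = dist (σ.symm i).1 (σ.symm j).1 := by
    intro i j
    rw [hq]
    simp only [dist_eq_norm, sub_sub_sub_cancel_right]
  have hsoftn : ∀ i, 1 - η ≤ ‖q i‖ ∧ ‖q i‖ ≤ 1 + η := by
    intro i
    rw [hqnorm]
    exact ⟨(h1u _ (hmem i).1 (hmem i).2.1).1, (hmem i).2.2⟩
  have hsoftp : ∀ i j, i ≠ j → 1 - η ≤ dist (q i) (q j) ∧
      (dist (q i) (q j) ≤ 1 + η ∨ 63 / 50 ≤ dist (q i) (q j)) := by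
    intro i j hij
    rw [hqdist]
    have hne : (σ.symm j).1 ≠ (σ.symm i).1 := fun h =>
      hij (σ.symm.injective (Subtype.ext h)).symm
    exact (hyp _ (hmem i).1 (hmem i).2.2).1 _ (hmem j).1 hne
  have good := hC η hη hηle q hsoftn hsoftp
  have key : ∀ w w' : {w : EuclideanSpace ℝ (Fin 3) // w ∈ S ∧ w ≠ u ∧ dist u w ≤ 1 + η},
      dist w.1 w'.1 = dist (q (σ w)) (q (σ w')) := by
    intro w w'
    rw [hqdist, Equiv.symm_apply_apply, Equiv.symm_apply_apply]
  rcases good with ⟨g, hg⟩ | ⟨g, hg⟩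
  · left
    refine ⟨σ.trans g, fun w w' hne => ?_⟩
    have hij : σ w ≠ σ w' := fun h => hne (σ.injective h)
    rw [key, Equiv.trans_apply, Equiv.trans_apply]
    exact hg (σ w) (σ w') hij
  · right
    refine ⟨σ.trans g, fun w w' hne => ?_⟩
    have hij : σ w ≠ σ w' := fun h => hne (σ.injective h)
    rw [key, Equiv.trans_apply, Equiv.trans_apply]
    exact hg (σ w) (σ w') hij

/-! ### Step 4. Assembly -/

/-- **`SoftLocalHales` from Hales's Theorem 3 with Lemma 9** (`Hales2012_contactGraphFccOrHcp`,
the contact graph of every `V ∈ 𝒱` is FCC or HCP), by compactness.  This is the old conditional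
form of the item (stmt-AtomisticToContinuum-9209) proved as an implication.
[cite: Hales2012, Theorem 3 and Lemma 9] -/
theorem softLocalHales_of_contactGraphFccOrHcp (hH : Hales2012_contactGraphFccOrHcp) :
    SoftLocalHales :=
  softLocalHales_of_soft_classification
    (soft_classification_of_exact (exists_equiv_pattern_of_contactGraphFccOrHcp hH))

/-- **`SoftLocalHales` from the computer-assisted part of Hales 2012 alone** (Theorem 3 with the
classification Lemma 8, the named fact `Hales2012_contactGraphTame`): Lemma 9 is proved in the tree
(`contactGraphFccOrHcp_of_contactGraphTame`). [cite: Hales2012, Theorem 3 and Lemma 8] -/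
theorem softLocalHales_of_contactGraphTame (hT : Hales2012_contactGraphTame) : SoftLocalHales :=
  softLocalHales_of_contactGraphFccOrHcp (contactGraphFccOrHcp_of_contactGraphTame hT)

end Summit.AtomisticToContinuum.Crystallization.Theorems

end
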